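import Summits.Parity.BatemanHorn.Theorems.NormalFamilyBound.Negative.Shape
import Summits.Parity.BatemanHorn.Theorems.NormalFamilyBound.Negative.Calibration
import Literature.NumberTheory.LFunctions.SelbergDelangeOmegaProofs

/-!
# Crux `NormalFamilyBound` (stmt-Parity-9769): the typed split into its parity-free and parity halves

Route `SelbergDelangeRigidity`, crux `Summit.Parity.BatemanHorn.Theses.SelbergDelangeRigidity.NormalFamilyBound`
(for every Bateman–Horn system `f` the family `H_x(z) = x⁻¹ (log x)^{k(1−z)} Σ_{n ≤ x} z^{Ω_f(n)}` is locally bounded on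
a thin rectangle `V_η = {−η < Re z < 7/4, |Im z| < η}`). Strategist decomposition after the exhausted ideation chain
(`Cruxes/NormalFamilyBound/STRATEGY-CENSUS.md`): the crux is EQUIVALENT to the conjunction of two statements of
different technique class, which from now on can be staffed, ideated and refuted separately —

* `PositiveRealPartBound` — the PARITY-FREE half: one bound `‖H_x(z)‖ ≤ M` on `{0 < Re z ≤ R', |Im z| < η}` for every
  `R' < 7/4` (complex Landau–Selberg–Delange UPPER BOUND along `f` to the right of the imaginary axis, uniform down to
  `Re z → 0⁺`; the saving asked over the positive-weight order of magnitude is `(log x)^{k(|z|−Re z)} ≤ (log x)^{3kη}`,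
  `η` the prover's; a `1 ± λ(F(n))` reweighting moves `H_x(z)` by `O((log x)^{−2k Re z}) = O(1)` relative to the
  bound, so Selberg's parity examples do not decide it);
* `SmallCircleBound` — the PARITY half: ONE small circle `‖z‖ = ρ(f)` on which `‖H_x(z)‖ ≤ M` for all `x`; at
  `z = −ρ` this is the real alternating almost-prime sum `|Σ_j π_j(x)(−ρ)^j| ≤ M x (log x)^{−k(1+ρ)}` (damped Liouville
  along `F = ∏ f_i` with saving `(log x)^{2kρ}`: the atom `RealSegmentParity`, necessary by
  `realSegmentParity_of_normalFamilyBound`, p90430), and by the maximum modulus principle for the ENTIRE function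
  `H_x` the circle carries the whole near-zero box `{−η < Re z ≤ 0, |Im z| < η}`, `η = ρ/2`.

Proved here (no `sorry`, standard axioms):
* `differentiable_H`, `norm_H_le_of_sphere` — `H_x` is entire; a bound on the circle `‖z‖ = ρ` holds on the closed disc;
* `NormalFamilyBound_of_subs : PositiveRealPartBound → SmallCircleBound → NormalFamilyBound` — SUFFICIENCY, the
  glue of the split (`η := min(η₁, ρ/2, 1/4)`; right half-ball from the first hypothesis at `R' = (Re a + 7/4)/2`, the
  points with `Re z ≤ 0` lie in the disc `‖z‖ < 2η ≤ ρ`);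
* `positiveRealPart_of_mem_locallyBoundedSystems`, `smallCircle_of_mem_locallyBoundedSystems` and the corollaries
  `positiveRealPartBound_of_normalFamilyBound`, `smallCircleBound_of_normalFamilyBound` — NECESSITY (finite subcover,
  `uniform_of_locallyBoundedOn` of `Negative/Shape.lean`): the split loses nothing, `normalFamilyBound_iff_subs`;
* `positiveRealPart_fX`, `smallCircle_fX` — both halves HOLD for the Bateman–Horn system `f = (X)` (Montgomery–Vaughan
  Thm 7.18, proved in the tree: `MontgomeryVaughan2007_thm_7_18_Omega_holds`, via `fX_mem_locallyBoundedSystems_of_MV`).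

Vocabulary `V`, `Ωf`, `H`, `locallyBoundedSystems` of `Theorems/NormalFamilyBound/Negative/RealAxis.lean`. The two
sub-crux `def`s below spell the family out verbatim (as the route file must), and `H k f x z` unfolds to it by `rfl`.
-/

namespace Summit.Parity.BatemanHorn.Theorems.NormalFamilyBound.Split

open Literature.NumberTheory.Sieve Polynomial Finset Filter
open Summit.Parity.BatemanHorn.Theses.SelbergDelangeRigidity
open Summit.Parity.BatemanHorn.Theorems.NormalFamilyBound.Negative
open Literature.NumberTheory.LFunctions (MontgomeryVaughan2007_thm_7_18_Omega
  MontgomeryVaughan2007_thm_7_18_Omega_holds)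

noncomputable section

/-! ## The two sub-cruxes (stated verbatim over Mathlib + Literature, as route items must be) -/

/-- SUB-CRUX 1, the parity-free half of `NormalFamilyBound`: for every Bateman–Horn system there is `η > 0` such that
for every `R' < 7/4` ONE constant bounds `‖H_x(z)‖` for all `x` on `{0 < Re z ≤ R', |Im z| < η}` — the complex
Landau–Selberg–Delange upper bound along `f` to the right of the imaginary axis (positive real points: the
Nair–Tenenbaum order of magnitude; off the axis: a saving `(log x)^{k(|z|−Re z)}`). [folklore] -/
def PositiveRealPartBound : Prop :=
  ∀ (k : ℕ) (f : Fin k → Polynomial ℤ), Literature.NumberTheory.Sieve.IsBatemanHornSystem f →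
    ∃ η : ℝ, 0 < η ∧ ∀ R' : ℝ, R' < 7 / 4 → ∃ M : ℝ, ∀ x : ℕ, ∀ z : ℂ, 0 < z.re → z.re ≤ R' → |z.im| < η →
      ‖(x : ℂ)⁻¹ * Complex.exp ((k : ℂ) * (1 - z) * (Real.log (Real.log x) : ℂ)) *
          ∑ n ∈ Finset.range (x + 1), z ^ (∑ i, ArithmeticFunction.cardFactors (((f i).eval (n : ℤ)).toNat))‖ ≤ M

/-- SUB-CRUX 2, the parity half of `NormalFamilyBound`: for every Bateman–Horn system there are `ρ > 0` and `M` with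
`‖H_x(z)‖ ≤ M` for all `x` and all `z` on the circle `‖z‖ = ρ` (at `z = −ρ`: the alternating almost-prime sum
`|Σ_j π_j(x)(−ρ)^j| ≤ M x (log x)^{−k(1+ρ)}`, damped Liouville along `F` with saving `(log x)^{2kρ}`). [folklore] -/
def SmallCircleBound : Prop :=
  ∀ (k : ℕ) (f : Fin k → Polynomial ℤ), Literature.NumberTheory.Sieve.IsBatemanHornSystem f →
    ∃ ρ : ℝ, 0 < ρ ∧ ∃ M : ℝ, ∀ x : ℕ, ∀ z : ℂ, ‖z‖ = ρ →
      ‖(x : ℂ)⁻¹ * Complex.exp ((k : ℂ) * (1 - z) * (Real.log (Real.log x) : ℂ)) *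
          ∑ n ∈ Finset.range (x + 1), z ^ (∑ i, ArithmeticFunction.cardFactors (((f i).eval (n : ℤ)).toNat))‖ ≤ M

/-! ## `H_x` is entire; maximum modulus from a circle about `0` -/

/-- Each `H_x` is an entire function of `z` (constant × exponential of an affine map × polynomial). [folklore] -/
theorem differentiable_H (k : ℕ) (f : Fin k → ℤ[X]) (x : ℕ) : Differentiable ℂ (H k f x) := by
  have h1 : Differentiable ℂ
      (fun z : ℂ => (x : ℂ)⁻¹ * Complex.exp ((k : ℂ) * (1 - z) * (Real.log (Real.log x) : ℂ))) :=
    (differentiable_const _).mul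
      ((((differentiable_const _).mul ((differentiable_const _).sub differentiable_id)).mul
        (differentiable_const _)).cexp)
  have h2 : Differentiable ℂ (fun z : ℂ =>
      ∑ n ∈ Finset.range (x + 1), z ^ (∑ i, ArithmeticFunction.cardFactors (((f i).eval (n : ℤ)).toNat))) :=
    Differentiable.fun_sum fun n _ => differentiable_id.pow _
  exact h1.mul h2

/-- MAXIMUM MODULUS for the family: a bound on the circle `‖w‖ = ρ` (`ρ > 0`) holds on the closed disc `‖z‖ ≤ ρ`.
[folklore] -/
theorem norm_H_le_of_sphere {k : ℕ} (f : Fin k → ℤ[X]) (x : ℕ) {ρ M : ℝ} (hρ : 0 < ρ)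
    (hM : ∀ w : ℂ, ‖w‖ = ρ → ‖H k f x w‖ ≤ M) {z : ℂ} (hz : ‖z‖ ≤ ρ) : ‖H k f x z‖ ≤ M := by
  have hdc : DiffContOnCl ℂ (H k f x) (Metric.ball (0 : ℂ) ρ) := (differentiable_H k f x).diffContOnCl
  refine Complex.norm_le_of_forall_mem_frontier_norm_le Metric.isBounded_ball hdc (fun w hw => ?_) ?_
  · rw [frontier_ball (0 : ℂ) hρ.ne', mem_sphere_zero_iff_norm] at hw
    exact hM w hw
  · rw [closure_ball (0 : ℂ) hρ.ne']
    exact Metric.mem_closedBall.mpr (by simpa using hz)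

/-! ## Sufficiency: the glue of the split -/

/-- **GLUE OF THE SPLIT (sufficiency).** `PositiveRealPartBound → SmallCircleBound → NormalFamilyBound`: with
`η := min(η₁, ρ/2, 1/4)`, a point `a ∈ V_η` gets the ball of radius `R' − Re a`, `R' := (Re a + 7/4)/2 < 7/4`; on it the
points with `Re z > 0` are bounded by sub-crux 1 at `R'`, and the points with `Re z ≤ 0` satisfy
`‖z‖ ≤ |Re z| + |Im z| < 2η ≤ ρ`, so sub-crux 2 bounds them through the maximum modulus principle. [folklore] -/
theorem NormalFamilyBound_of_subs (h₁ : PositiveRealPartBound) (h₂ : SmallCircleBound) : NormalFamilyBound := by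
  intro k f hf
  obtain ⟨η₁, hη₁, hR⟩ := h₁ k f hf
  obtain ⟨ρ, hρ, M₂, hM₂⟩ := h₂ k f hf
  set η : ℝ := min (min η₁ (ρ / 2)) (1 / 4) with hηdef
  have hη : 0 < η := lt_min (lt_min hη₁ (by linarith)) (by norm_num)
  have hηη₁ : η ≤ η₁ := (min_le_left _ _).trans (min_le_left _ _)
  have hηρ : η ≤ ρ / 2 := (min_le_left _ _).trans (min_le_right _ _)
  have hη4 : η ≤ 1 / 4 := min_le_right _ _
  refine ⟨η, hη, hη4, fun a ha => ?_⟩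
  obtain ⟨-, ha2, -⟩ := ha
  set R' : ℝ := (a.re + 7 / 4) / 2 with hR'def
  have hR'lt : R' < 7 / 4 := by rw [hR'def]; linarith
  have haR' : a.re < R' := by rw [hR'def]; linarith
  obtain ⟨M₁, hM₁⟩ := hR R' hR'lt
  refine ⟨max M₁ M₂, R' - a.re, by linarith, fun x z hz => ?_⟩
  obtain ⟨hzb, hz1, -, hz3⟩ := hz
  have hzre : z.re ≤ R' := by
    have hd : ‖z - a‖ < R' - a.re := by rwa [Metric.mem_ball, Complex.dist_eq] at hzb
    have h1 : |(z - a).re| ≤ ‖z - a‖ := Complex.abs_re_le_norm (z - a)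
    rw [Complex.sub_re] at h1
    have h2 := (abs_le.mp (h1.trans hd.le)).2
    linarith
  by_cases hpos : 0 < z.re
  · exact (hM₁ x z hpos hzre (lt_of_lt_of_le hz3 hηη₁)).trans (le_max_left _ _)
  · push Not at hpos
    have hnorm : ‖z‖ ≤ ρ := by
      have h := Complex.norm_le_abs_re_add_abs_im z
      have hre : |z.re| < η := by rw [abs_lt]; constructor <;> linarith
      linarith
    exact (norm_H_le_of_sphere f x hρ (fun w hw => hM₂ x w hw) hnorm).trans (le_max_right _ _)

/-! ## Necessity: both halves are restrictions of the crux -/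

/-- NECESSITY of sub-crux 1 for one system: local boundedness on `V_{7/4,η}` (ball form) gives, for every `R' < 7/4`,
one constant on `{0 < Re z ≤ R', |Im z| < η/2}` (finite subcover on the closed rectangle `[−η/2, R'] × [−η/2, η/2]`).
[folklore] -/
theorem positiveRealPart_of_mem_locallyBoundedSystems {k : ℕ} {f : Fin k → ℤ[X]}
    (h : f ∈ locallyBoundedSystems (7 / 4) k) :
    ∃ η : ℝ, 0 < η ∧ ∀ R' : ℝ, R' < 7 / 4 → ∃ M : ℝ, ∀ x : ℕ, ∀ z : ℂ,
      0 < z.re → z.re ≤ R' → |z.im| < η → ‖H k f x z‖ ≤ M := by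
  obtain ⟨η, hη, -, hB⟩ := h
  refine ⟨η / 2, by linarith, fun R' hR' => ?_⟩
  obtain ⟨M, hM⟩ := uniform_of_locallyBoundedOn hB hR' (show η / 2 < η by linarith)
  exact ⟨M, fun x z h1 h2 h3 => hM x z (by linarith) h2 h3.le⟩

/-- NECESSITY of sub-crux 2 for one system: local boundedness on `V_{7/4,η}` (ball form) gives one constant on the
circle `‖z‖ = η/2` (inside the closed square `[−η/2, η/2]²`). [folklore] -/
theorem smallCircle_of_mem_locallyBoundedSystems {k : ℕ} {f : Fin k → ℤ[X]}
    (h : f ∈ locallyBoundedSystems (7 / 4) k) :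
    ∃ ρ : ℝ, 0 < ρ ∧ ∃ M : ℝ, ∀ x : ℕ, ∀ z : ℂ, ‖z‖ = ρ → ‖H k f x z‖ ≤ M := by
  obtain ⟨η, hη, hη4, hB⟩ := h
  obtain ⟨M, hM⟩ := uniform_of_locallyBoundedOn hB (show η / 2 < 7 / 4 by linarith) (show η / 2 < η by linarith)
  refine ⟨η / 2, by linarith, M, fun x z hz => ?_⟩
  have hre : |z.re| ≤ η / 2 := hz ▸ Complex.abs_re_le_norm z
  have him : |z.im| ≤ η / 2 := hz ▸ Complex.abs_im_le_norm z
  exact hM x z (abs_le.mp hre).1 (abs_le.mp hre).2 him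

/-- Hence the crux implies sub-crux 1. [folklore] -/
theorem positiveRealPartBound_of_normalFamilyBound (h : NormalFamilyBound) : PositiveRealPartBound :=
  fun k f hf => positiveRealPart_of_mem_locallyBoundedSystems (normalFamilyBound_iff.mp h k f hf)

/-- Hence the crux implies sub-crux 2. [folklore] -/
theorem smallCircleBound_of_normalFamilyBound (h : NormalFamilyBound) : SmallCircleBound :=
  fun k f hf => smallCircle_of_mem_locallyBoundedSystems (normalFamilyBound_iff.mp h k f hf)

/-- THE SPLIT LOSES NOTHING: `NormalFamilyBound ↔ PositiveRealPartBound ∧ SmallCircleBound`. [folklore] -/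
theorem normalFamilyBound_iff_subs : NormalFamilyBound ↔ PositiveRealPartBound ∧ SmallCircleBound :=
  ⟨fun h => ⟨positiveRealPartBound_of_normalFamilyBound h, smallCircleBound_of_normalFamilyBound h⟩,
    fun h => NormalFamilyBound_of_subs h.1 h.2⟩

/-! ## Calibration: both halves hold for the Bateman–Horn system `f = (X)` (Montgomery–Vaughan Thm 7.18, proved) -/

/-- Sub-crux 1 holds for `f = (X)`: the Selberg–Delange law for `Σ_{n ≤ x} z^{Ω(n)}` (MV Thm 7.18, proved in the
tree) makes the family locally bounded on `V_{7/4,1/4}`. [cite: MontgomeryVaughan2007, Thm 7.18] -/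
theorem positiveRealPart_fX :
    ∃ η : ℝ, 0 < η ∧ ∀ R' : ℝ, R' < 7 / 4 → ∃ M : ℝ, ∀ x : ℕ, ∀ z : ℂ,
      0 < z.re → z.re ≤ R' → |z.im| < η → ‖H 1 fX x z‖ ≤ M :=
  positiveRealPart_of_mem_locallyBoundedSystems
    (fX_mem_locallyBoundedSystems_of_MV MontgomeryVaughan2007_thm_7_18_Omega_holds)

/-- Sub-crux 2 holds for `f = (X)` (same source). [cite: MontgomeryVaughan2007, Thm 7.18] -/
theorem smallCircle_fX :
    ∃ ρ : ℝ, 0 < ρ ∧ ∃ M : ℝ, ∀ x : ℕ, ∀ z : ℂ, ‖z‖ = ρ → ‖H 1 fX x z‖ ≤ M :=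
  smallCircle_of_mem_locallyBoundedSystems
    (fX_mem_locallyBoundedSystems_of_MV MontgomeryVaughan2007_thm_7_18_Omega_holds)

end

end Summit.Parity.BatemanHorn.Theorems.NormalFamilyBound.Split
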